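import Literature.Analysis.FunctionSpaces.DistributionalConstancy
import Mathlib.MeasureTheory.Integral.IntervalIntegral.FundThmCalculus
import Mathlib.MeasureTheory.Integral.IntervalIntegral.IntegrationByParts
import Mathlib.MeasureTheory.Integral.DominatedConvergence
import Mathlib.MeasureTheory.Integral.Prod
import Mathlib.Analysis.Distribution.AEEqOfIntegralContDiff
import Mathlib.Analysis.Normed.Module.Dual
import Mathlib.Analysis.InnerProductSpace.PiL2
import Mathlib.MeasureTheory.Measure.Haar.OfBasis
import HarnessLib

/-!
# A continuous weak solution of `∂ₜ w = g` with continuous right-hand side is a classical one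

Analysis/FunctionSpaces support file (everything proved, no named facts): the du Bois-Reymond
lemma *with a right-hand side* on an open interval, and its space–time version for fields that
are merely continuous on an open product set `I × S`. This is the step by which a distributional
evolution equation `∂ₜ w = g` whose two sides are known to be (jointly) continuous is turned
into a pointwise identity `w(t, x) - w(s, x) = ∫ₛᵗ g(τ, x) dτ`, hence into a classical time
derivative `∂ₜ w(t, x) = g(t, x)` at every point (e.g. the vorticity equation of a Navier–Stokes
solution that is smooth in space and continuous in time, where the momentum equation itself need
not hold classically; Serrin 1962, §§1–2).

* `sub_eq_intervalIntegral_of_forall_test` — **du Bois-Reymond with a right-hand side**: if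
  `A, B` are continuous on `(a, b)` and `∫ (η' A + η B) = 0` for every smooth `η` compactly
  supported in `(a, b)`, then `A t - A s = ∫ₛᵗ B` for all `s, t ∈ (a, b)` (Brezis 2011,
  Lemma 8.1 / Thm. 8.2: subtract a primitive of `B` and apply the tree's
  `ae_eq_const_of_forall_setIntegral_deriv_mul_eq_zero` on a compact window, then continuity);
  `sub_eq_intervalIntegral_of_forall_test_of_normedSpace` is the vector-valued form (through
  the dual, `NormedSpace.eq_iff_forall_dual_eq`).
* `sub_eq_intervalIntegral_of_forall_product_test` — **fields**: if `w, g : ℝ → ℝⁿ → F` are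
  jointly continuous on `(a, b) × S` (`S` open) and
  `∫∫ ((η' θ) • w + (η θ) • g) = 0` for all smooth `η` compactly supported in `(a, b)` and
  smooth `θ` compactly supported in `S`, then `w(t, x) - w(s, x) = ∫ₛᵗ g(τ, x) dτ` for all
  `x ∈ S`, `s, t ∈ (a, b)` (the previous lemma for `t ↦ ∫ θ • w(t)`, Fubini, and the
  fundamental lemma of the calculus of variations `IsOpen.ae_eq_zero_of_integral_contDiff_smul_eq_zero`
  for the continuous field `w(t) - w(s) - ∫ₛᵗ g`), and `hasDerivAt_of_forall_product_test` —
  the classical time derivative `∂ₜ w(t, x) = g(t, x)` at every point of `(a, b) × S`.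

## Mathlib search

Mathlib (this pin) has the fundamental lemma of the calculus of variations
(`IsOpen.ae_eq_zero_of_integral_contDiff_smul_eq_zero`) and the FTC for interval integrals, but
no du Bois-Reymond lemma; the tree has the homogeneous version
`Literature.Analysis.FunctionSpaces.ae_eq_const_of_forall_setIntegral_deriv_mul_eq_zero`
(`DistributionalConstancy`) and versions with an initial datum on `(0, T)` (`DuBoisReymond`,
`DuBoisReymondAE`), none with a right-hand side on a general interval nor for fields.

## References

* H. Brezis, *Functional Analysis, Sobolev Spaces and PDE* (Springer 2011), Lemma 8.1, Thm. 8.2.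
* J. Serrin, *On the interior regularity of weak solutions of the Navier–Stokes equations*,
  Arch. Rational Mech. Anal. 9 (1962) 187–195, §§1–2.
-/

noncomputable section

open MeasureTheory TopologicalSpace Set Function Filter Metric intervalIntegral
open _root_.Topology
open scoped ENNReal NNReal ContDiff

namespace Literature.Analysis.FunctionSpaces

/-! ### Du Bois-Reymond with a right-hand side on an open interval -/

section Scalar

/-- An integral over `Ioo a b` of a function vanishing off a subset of `Ioo a b` is the integral
over the whole line. [folklore] -/
theorem setIntegral_Ioo_eq_integral_of_support_subset {F : Type*} [NormedAddCommGroup F]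
    [NormedSpace ℝ F] {f : ℝ → F} {a b : ℝ} (h : support f ⊆ Ioo a b) :
    ∫ t in Ioo a b, f t = ∫ t, f t :=
  setIntegral_eq_integral_of_forall_compl_eq_zero fun t ht => by
    by_contra h'
    exact ht (h (mem_support.2 h'))

/-- **Du Bois-Reymond lemma with a right-hand side.** Let `A, B : ℝ → ℝ` be continuous on the
open interval `(a, b)` and suppose that `∫_{(a,b)} (η' A + η B) = 0` for every smooth `η` with
compact support in `(a, b)` (i.e. `A' = B` in `𝒟'(a, b)`). Then `A t - A s = ∫ₛᵗ B` for all
`s, t ∈ (a, b)`; in particular `A` is `C¹` with `A' = B` (Brezis 2011, Lemma 8.1 and Thm. 8.2).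
Proof: on a compact window `[a', b'] ⊆ (a, b)` around `s, t`, the primitive `P` of `B` satisfies
`∫ η' P = -∫ η B`, so `∫ η' (A - P) = 0` for all `η` supported in `(a', b')`, whence `A - P` is
a.e., and by continuity everywhere, constant on `(a', b')`. [cite: Brezis2011, Lemma 8.1] -/
theorem sub_eq_intervalIntegral_of_forall_test {a b : ℝ} {A B : ℝ → ℝ}
    (hA : ContinuousOn A (Ioo a b)) (hB : ContinuousOn B (Ioo a b))
    (h : ∀ η : ℝ → ℝ, ContDiff ℝ ∞ η → HasCompactSupport η → tsupport η ⊆ Ioo a b →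
      ∫ t in Ioo a b, (deriv η t * A t + η t * B t) = 0)
    {s t : ℝ} (hs : s ∈ Ioo a b) (ht : t ∈ Ioo a b) :
    A t - A s = ∫ τ in s..t, B τ := by
  -- a compact window `[a', b'] ⊆ (a, b)` with `s, t ∈ (a', b')`
  set a' : ℝ := (a + min s t) / 2 with ha'
  set b' : ℝ := (max s t + b) / 2 with hb'
  have hmin : a < min s t := lt_min hs.1 ht.1
  have hmax : max s t < b := max_lt hs.2 ht.2
  have haa' : a < a' := by rw [ha']; linarith
  have ha's : a' < min s t := by rw [ha']; linarith
  have hb't : max s t < b' := by rw [hb']; linarith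
  have hb'b : b' < b := by rw [hb']; linarith
  have ha'b' : a' < b' := by
    have := min_le_max (a := s) (b := t); linarith
  have hsub : Icc a' b' ⊆ Ioo a b := fun τ hτ => ⟨haa'.trans_le hτ.1, hτ.2.trans_lt hb'b⟩
  have hsubo : Ioo a' b' ⊆ Ioo a b := Ioo_subset_Icc_self.trans hsub
  have hsI : s ∈ Ioo a' b' := ⟨ha's.trans_le (min_le_left _ _), (le_max_left _ _).trans_lt hb't⟩
  have htI : t ∈ Ioo a' b' := ⟨ha's.trans_le (min_le_right _ _), (le_max_right _ _).trans_lt hb't⟩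
  -- the truncated right-hand side `B'` and its primitive `P`
  set B' : ℝ → ℝ := (Icc a' b').indicator B with hB'def
  have hBi : IntegrableOn B (Icc a' b') := (hB.mono hsub).integrableOn_compact isCompact_Icc
  have hB'i : Integrable B' volume := hBi.integrable_indicator measurableSet_Icc
  have hB'eq : ∀ τ ∈ Icc a' b', B' τ = B τ := fun τ hτ => indicator_of_mem hτ _
  set P : ℝ → ℝ := fun τ => ∫ r in a'..τ, B' r with hPdef
  have hPc : Continuous P :=
    intervalIntegral.continuous_primitive (fun _ _ => hB'i.intervalIntegrable) a'
  have hB'c : ∀ τ ∈ Ioo a' b', ContinuousAt B' τ := by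
    intro τ hτ
    have h1 : B' =ᶠ[𝓝 τ] B := by
      filter_upwards [Ioo_mem_nhds hτ.1 hτ.2] with r hr
      exact hB'eq r (Ioo_subset_Icc_self hr)
    exact (hB.continuousAt (Ioo_mem_nhds (hsubo hτ).1 (hsubo hτ).2)).congr_of_eventuallyEq h1
  have hPd : ∀ τ ∈ Ioo a' b', HasDerivAt P (B τ) τ := by
    intro τ hτ
    have h1 : HasDerivAt P (B' τ) τ :=
      intervalIntegral.integral_hasDerivAt_right (hB'i.intervalIntegrable)
        (hB'i.aestronglyMeasurable.stronglyMeasurableAtFilter) (hB'c τ hτ)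
    rwa [hB'eq τ (Ioo_subset_Icc_self hτ)] at h1
  -- `∫_{(a',b')} η' (A - P) = 0` for every test function `η` on `(a', b')`
  have hkey : ∀ η : ℝ → ℝ, ContDiff ℝ ∞ η → HasCompactSupport η → tsupport η ⊆ Ioo a' b' →
      ∫ τ in Ioo a' b', deriv η τ * (A τ - P τ) = 0 := by
    intro η hη hηc hηs
    have hηd : ∀ τ, HasDerivAt η (deriv η τ) τ := fun τ =>
      (hη.differentiable (by simp) τ).hasDerivAt
    have hη0 : ∀ τ, τ ∉ Ioo a' b' → η τ = 0 := fun τ hτ =>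
      image_eq_zero_of_notMem_tsupport fun h' => hτ (hηs h')
    have hdη0 : ∀ τ, τ ∉ Ioo a' b' → deriv η τ = 0 := fun τ hτ => by
      by_contra h'
      exact hτ (hηs (support_deriv_subset (mem_support.2 h')))
    -- the hypothesis, as an integral over the whole line
    have h1 : ∫ τ, (deriv η τ * A τ + η τ * B τ) = 0 := by
      rw [← h η hη hηc (hηs.trans hsubo)]
      refine (setIntegral_Ioo_eq_integral_of_support_subset fun τ hτ => ?_).symm
      by_contra hτ'
      have hτ'' : τ ∉ Ioo a' b' := fun h'' => hτ' (hsubo h'')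
      simp only [mem_support, hη0 τ hτ'', hdη0 τ hτ'', zero_mul, add_zero, ne_eq,
        not_true_eq_false] at hτ
    -- integration by parts against the primitive: `∫ (η' P + η B) = 0` on `[a', b']`
    have hcontA : ContinuousOn (fun τ => deriv η τ * A τ + η τ * B τ) (Icc a' b') :=
      ((hη.continuous_deriv (by simp)).continuousOn.mul (hA.mono hsub)).add
        (hη.continuous.continuousOn.mul (hB.mono hsub))
    have h2 : ∫ τ in a'..b', (deriv η τ * P τ + η τ * B τ) = 0 := by
      have hibp := intervalIntegral.integral_deriv_mul_eq_sub_of_hasDerivAt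
        (u := η) (v := P) (u' := deriv η) (v' := B) (a := a') (b := b')
        hη.continuous.continuousOn hPc.continuousOn
        (fun τ _ => hηd τ) (fun τ hτ => hPd τ (by rwa [min_eq_left ha'b'.le, max_eq_right ha'b'.le] at hτ))
        ((hη.continuous_deriv (by simp)).intervalIntegrable _ _)
        ((hB.mono hsub).intervalIntegrable_of_Icc ha'b'.le)
      rw [hibp, hη0 a' (fun h' => lt_irrefl _ h'.1), hη0 b' (fun h' => lt_irrefl _ h'.2)]
      ring
    -- the hypothesis on the window `[a', b']`
    have h3 : ∫ τ in a'..b', (deriv η τ * A τ + η τ * B τ) = 0 := by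
      rw [intervalIntegral.integral_of_le ha'b'.le, ← h1]
      refine setIntegral_eq_integral_of_forall_compl_eq_zero fun τ hτ => ?_
      have hτ' : τ ∉ Ioo a' b' := fun h' => hτ (Ioo_subset_Ioc_self h')
      simp [hη0 τ hτ', hdη0 τ hτ']
    -- subtract
    have hi1 : IntervalIntegrable (fun τ => deriv η τ * A τ + η τ * B τ) volume a' b' :=
      hcontA.intervalIntegrable_of_Icc ha'b'.le
    have hi2 : IntervalIntegrable (fun τ => deriv η τ * P τ + η τ * B τ) volume a' b' :=
      ((((hη.continuous_deriv (by simp)).mul hPc).continuousOn).add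
        (hη.continuous.continuousOn.mul (hB.mono hsub))).intervalIntegrable_of_Icc ha'b'.le
    have h4 : ∫ τ in a'..b', deriv η τ * (A τ - P τ) = 0 := by
      have e : (fun τ => deriv η τ * (A τ - P τ)) =
          fun τ => (deriv η τ * A τ + η τ * B τ) - (deriv η τ * P τ + η τ * B τ) := by
        funext τ; ring
      rw [e, intervalIntegral.integral_sub hi1 hi2, h2, h3, sub_zero]
    rw [intervalIntegral.integral_of_le ha'b'.le, integral_Ioc_eq_integral_Ioo] at h4
    exact h4
  -- `A - P` is a.e. constant on `(a', b')`, hence constant by continuity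
  have hAPi : IntegrableOn (fun τ => A τ - P τ) (Ioo a' b') :=
    (((hA.mono hsub).sub hPc.continuousOn).integrableOn_compact isCompact_Icc).mono_set
      Ioo_subset_Icc_self
  obtain ⟨c, hc⟩ := ae_eq_const_of_forall_setIntegral_deriv_mul_eq_zero hAPi hkey
  have hAPc : ContinuousOn (fun τ => A τ - P τ) (Ioo a' b') := (hA.mono hsubo).sub hPc.continuousOn
  have hconst : EqOn (fun τ => A τ - P τ) (fun _ => c) (Ioo a' b') :=
    Measure.eqOn_open_of_ae_eq hc isOpen_Ioo hAPc continuousOn_const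
  have hAt : A t - P t = c := hconst htI
  have hAs : A s - P s = c := hconst hsI
  -- conclude with `P t - P s = ∫ₛᵗ B' = ∫ₛᵗ B`
  have hPts : P t - P s = ∫ τ in s..t, B' τ :=
    intervalIntegral.integral_interval_sub_left hB'i.intervalIntegrable hB'i.intervalIntegrable
  have hBB' : ∫ τ in s..t, B' τ = ∫ τ in s..t, B τ := by
    refine intervalIntegral.integral_congr fun τ hτ => hB'eq τ ?_
    have h1 : uIcc s t ⊆ Icc a' b' := uIcc_subset_Icc (Ioo_subset_Icc_self hsI)
      (Ioo_subset_Icc_self htI)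
    exact h1 hτ
  calc A t - A s = (A t - P t) - (A s - P s) + (P t - P s) := by ring
    _ = ∫ τ in s..t, B τ := by rw [hAt, hAs, sub_self, zero_add, hPts, hBB']

/-- **Du Bois-Reymond with a right-hand side, vector-valued.** The same statement for
`A, B : ℝ → F` with values in a real normed space, the hypothesis being
`∫_{(a,b)} (η' • A + η • B) = 0` (apply the scalar lemma to `ℓ ∘ A`, `ℓ ∘ B` for every
continuous linear functional `ℓ` and separate points by the dual). [cite: Brezis2011, Lemma 8.1] -/
theorem sub_eq_intervalIntegral_of_forall_test_of_normedSpace {F : Type*} [NormedAddCommGroup F]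
    [NormedSpace ℝ F] [CompleteSpace F] {a b : ℝ} {A B : ℝ → F}
    (hA : ContinuousOn A (Ioo a b)) (hB : ContinuousOn B (Ioo a b))
    (h : ∀ η : ℝ → ℝ, ContDiff ℝ ∞ η → HasCompactSupport η → tsupport η ⊆ Ioo a b →
      ∫ t in Ioo a b, (deriv η t • A t + η t • B t) = 0)
    {s t : ℝ} (hs : s ∈ Ioo a b) (ht : t ∈ Ioo a b) :
    A t - A s = ∫ τ in s..t, B τ := by
  rw [SeparatingDual.eq_iff_forall_dual_eq (R := ℝ)]
  intro ℓ
  have hBi : IntervalIntegrable B volume s t := by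
    refine (hB.mono ?_).intervalIntegrable
    exact (uIcc_subset_Icc ⟨min_le_left s t, le_max_left s t⟩ ⟨min_le_right s t, le_max_right s t⟩).trans
      (Icc_subset_Ioo (lt_min hs.1 ht.1) (max_lt hs.2 ht.2))
  rw [map_sub, ← ℓ.intervalIntegral_comp_comm hBi]
  refine sub_eq_intervalIntegral_of_forall_test (A := fun τ => ℓ (A τ)) (B := fun τ => ℓ (B τ))
    (ℓ.continuous.comp_continuousOn hA) (ℓ.continuous.comp_continuousOn hB) (fun η hη hηc hηs => ?_)
    hs ht
  -- integrability of the two summands on `Ioo a b` (continuous, compactly supported inside)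
  have hη0 : ∀ τ, τ ∉ tsupport η → η τ = 0 := fun τ hτ => image_eq_zero_of_notMem_tsupport hτ
  have hdη0 : ∀ τ, τ ∉ tsupport η → deriv η τ = 0 := fun τ hτ => by
    by_contra h'
    exact hτ (support_deriv_subset (mem_support.2 h'))
  have hc1 : Continuous fun τ => deriv η τ • A τ + η τ • B τ := by
    rw [continuous_iff_continuousAt]
    intro τ
    by_cases hτ : τ ∈ Ioo a b
    · have hAτ := hA.continuousAt (Ioo_mem_nhds hτ.1 hτ.2)
      have hBτ := hB.continuousAt (Ioo_mem_nhds hτ.1 hτ.2)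
      exact ((hη.continuous_deriv (by simp)).continuousAt.smul hAτ).add
        (hη.continuous.continuousAt.smul hBτ)
    · have hτ' : τ ∉ tsupport η := fun h' => hτ (hηs h')
      have h0 : (fun τ => deriv η τ • A τ + η τ • B τ) =ᶠ[𝓝 τ] fun _ => 0 := by
        filter_upwards [notMem_tsupport_iff_eventuallyEq.1 hτ',
          (isClosed_tsupport η).isOpen_compl.mem_nhds hτ'] with r hr hr'
        simp [hη0 r hr', hdη0 r hr']
      exact continuousAt_const.congr h0.symm
  have hsupp : support (fun τ => deriv η τ • A τ + η τ • B τ) ⊆ tsupport η := by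
    intro τ hτ
    by_contra hτ'
    simp [hη0 τ hτ', hdη0 τ hτ'] at hτ
  have hint : Integrable (fun τ => deriv η τ • A τ + η τ • B τ) volume :=
    hc1.integrable_of_hasCompactSupport (hηc.mono' hsupp)
  have h1 := h η hη hηc hηs
  have e : (fun τ => deriv η τ * ℓ (A τ) + η τ * ℓ (B τ)) =
      fun τ => ℓ (deriv η τ • A τ + η τ • B τ) := by
    funext τ; simp
  rw [e, ℓ.integral_comp_comm hint.integrableOn, h1, map_zero]

end Scalar

/-! ### Fields: the weak-to-classical time derivative on an open product set -/

section Fields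

variable {ι : Type*} [Fintype ι]
variable {F : Type*} [NormedAddCommGroup F] [NormedSpace ℝ F]

omit [Fintype ι] in
/-- A product `θ • V` with `θ` continuous, `tsupport θ ⊆ S`, `S` open, and `V` continuous on
`S` is continuous on the whole space (off `tsupport θ` it vanishes near every point). [folklore] -/
theorem continuous_smul_of_continuousOn_of_tsupport_subset {S : Set (EuclideanSpace ℝ ι)}
    (hS : IsOpen S) {V : EuclideanSpace ℝ ι → F} (hV : ContinuousOn V S)
    {θ : EuclideanSpace ℝ ι → ℝ} (hθ : Continuous θ) (hθS : tsupport θ ⊆ S) :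
    Continuous fun x => θ x • V x := by
  rw [continuous_iff_continuousAt]
  intro x
  by_cases hx : x ∈ S
  · exact hθ.continuousAt.smul (hV.continuousAt (hS.mem_nhds hx))
  · have hx' : x ∉ tsupport θ := fun h => hx (hθS h)
    have h0 : (fun y => θ y • V y) =ᶠ[𝓝 x] fun _ => 0 := by
      filter_upwards [notMem_tsupport_iff_eventuallyEq.1 hx'] with y hy
      simp [hy]
    exact (continuousAt_const (y := (0 : F))).congr h0.symm

omit [Fintype ι] in
/-- The support of `θ • V` lies in the topological support of `θ`. [folklore] -/
theorem support_smul_subset_tsupport {V : EuclideanSpace ℝ ι → F} {θ : EuclideanSpace ℝ ι → ℝ} :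
    support (fun x => θ x • V x) ⊆ tsupport θ := by
  intro x hx
  by_contra hx'
  exact hx (by simp [image_eq_zero_of_notMem_tsupport hx'])

/-- **Pairings of a jointly continuous field with a test function are continuous in time**: if
`w` is jointly continuous on `(a, b) × S` (`S` open) and `θ` is continuous with compact support
`tsupport θ ⊆ S`, then `t ↦ ∫ θ • w(t)` is continuous on `(a, b)` (continuity of parametric
integrals of continuous integrands over a compact set, on the locally compact parameter space
`(a, b)`). [folklore] -/
theorem continuousOn_integral_smul_of_continuousOn_prod {a b : ℝ} {S : Set (EuclideanSpace ℝ ι)}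
    (hS : IsOpen S) {w : ℝ → EuclideanSpace ℝ ι → F}
    (hw : ContinuousOn (uncurry w) (Ioo a b ×ˢ S)) {θ : EuclideanSpace ℝ ι → ℝ}
    (hθ : Continuous θ) (hθc : HasCompactSupport θ) (hθS : tsupport θ ⊆ S) :
    ContinuousOn (fun t => ∫ x, θ x • w t x) (Ioo a b) := by
  haveI : LocallyCompactSpace (Ioo a b) := isOpen_Ioo.locallyCompactSpace
  -- the integrand on the subtype `(a, b)`, jointly continuous
  set f : Ioo a b → EuclideanSpace ℝ ι → F := fun t x => θ x • w t x with hf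
  have hfc : Continuous (uncurry f) := by
    rw [continuous_iff_continuousAt]
    rintro ⟨t, x⟩
    by_cases hx : x ∈ S
    · have h1 : ContinuousAt (uncurry w) ((t : ℝ), x) :=
        hw.continuousAt ((isOpen_Ioo.prod hS).mem_nhds ⟨t.2, hx⟩)
      have h2 : ContinuousAt (fun p : Ioo a b × EuclideanSpace ℝ ι => ((p.1 : ℝ), p.2)) (t, x) :=
        (continuous_subtype_val.prodMap continuous_id).continuousAt
      have h3 : ContinuousAt (fun p : Ioo a b × EuclideanSpace ℝ ι => uncurry w ((p.1 : ℝ), p.2))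
          (t, x) := ContinuousAt.comp (g := uncurry w) h1 h2
      exact ((hθ.continuousAt (x := x)).comp continuousAt_snd).smul h3
    · have hx' : x ∉ tsupport θ := fun h => hx (hθS h)
      have h0 : uncurry f =ᶠ[𝓝 (t, x)] fun _ => 0 := by
        have h1 : ∀ᶠ p : Ioo a b × EuclideanSpace ℝ ι in 𝓝 (t, x), θ p.2 = 0 :=
          (continuous_snd.tendsto (t, x)).eventually (notMem_tsupport_iff_eventuallyEq.1 hx')
        filter_upwards [h1] with p hp
        simp [hf, uncurry, hp]
      exact (continuousAt_const (y := (0 : F))).congr h0.symm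
  have hcont : Continuous fun t : Ioo a b => ∫ x in tsupport θ, f t x :=
    continuous_parametric_integral_of_continuous hfc hθc
  have heq : ∀ t : Ioo a b, ∫ x in tsupport θ, f t x = ∫ x, θ x • w t x := fun t =>
    setIntegral_eq_integral_of_forall_compl_eq_zero fun x hx => by
      simp [hf, image_eq_zero_of_notMem_tsupport hx]
  rw [continuousOn_iff_continuous_restrict]
  have e : (Ioo a b).restrict (fun t => ∫ x, θ x • w t x) = fun t : Ioo a b => ∫ x in tsupport θ, f t x := by
    funext t
    rw [heq t]
    rfl
  rw [e]
  exact hcont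

/-- **Continuity in `x` of the time integral `x ↦ ∫ₛᵗ g(τ, x) dτ`** of a field jointly
continuous on `(a, b) × S`, at points of the open set `S`, for `s, t ∈ (a, b)` (dominated
convergence with a constant bound on a compact neighbourhood). [folklore] -/
theorem continuousOn_intervalIntegral_of_continuousOn_prod {a b : ℝ} {S : Set (EuclideanSpace ℝ ι)}
    (hS : IsOpen S) {g : ℝ → EuclideanSpace ℝ ι → F}
    (hg : ContinuousOn (uncurry g) (Ioo a b ×ˢ S)) {s t : ℝ} (hs : s ∈ Ioo a b)
    (ht : t ∈ Ioo a b) : ContinuousOn (fun x => ∫ τ in s..t, g τ x) S := by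
  intro x₀ hx₀
  refine ContinuousAt.continuousWithinAt ?_
  -- a compact neighbourhood `closedBall x₀ ε ⊆ S` and a bound of `g` on `[s, t] × closedBall x₀ ε`
  obtain ⟨ε, hε, hεS⟩ : ∃ ε > 0, closedBall x₀ ε ⊆ S := by
    obtain ⟨δ, hδ, hδS⟩ := Metric.isOpen_iff.1 hS x₀ hx₀
    exact ⟨δ / 2, half_pos hδ, closedBall_subset_ball (half_lt_self hδ) |>.trans hδS⟩
  have hIab : uIcc s t ⊆ Ioo a b :=
    (uIcc_subset_Icc ⟨min_le_left s t, le_max_left s t⟩ ⟨min_le_right s t, le_max_right s t⟩).trans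
      (Icc_subset_Ioo (lt_min hs.1 ht.1) (max_lt hs.2 ht.2))
  have hK : IsCompact (uIcc s t ×ˢ closedBall x₀ ε) :=
    isCompact_uIcc.prod (isCompact_closedBall _ _)
  obtain ⟨M, hM⟩ := hK.exists_bound_of_continuousOn (hg.mono (prod_mono hIab hεS))
  refine intervalIntegral.continuousAt_of_dominated_interval (bound := fun _ => M) ?_ ?_
    intervalIntegrable_const ?_
  · filter_upwards [hS.mem_nhds hx₀] with x hx
    exact ((hg.uncurry_right x hx).mono
      (uIoc_subset_uIcc.trans hIab)).aestronglyMeasurable measurableSet_uIoc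
  · filter_upwards [closedBall_mem_nhds x₀ hε] with x hx
    exact Eventually.of_forall fun τ hτ => hM (τ, x) ⟨uIoc_subset_uIcc hτ, hx⟩
  · refine Eventually.of_forall fun τ hτ => ?_
    have hτ' : τ ∈ Ioo a b := hIab (uIoc_subset_uIcc hτ)
    exact (hg.uncurry_left τ hτ').continuousAt (hS.mem_nhds hx₀)

/-- **Fubini for the pairing of a time integral**: for `g` jointly continuous on
`(a, b) × S`, `θ` continuous with compact support in `S`, and `s, t ∈ (a, b)`,
`∫ θ(x) • (∫ₛᵗ g(τ, x) dτ) dx = ∫ₛᵗ (∫ θ(x) • g(τ, x) dx) dτ`. [folklore] -/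
theorem integral_smul_intervalIntegral_comm {a b : ℝ} {S : Set (EuclideanSpace ℝ ι)}
    (hS : IsOpen S) {g : ℝ → EuclideanSpace ℝ ι → F}
    (hg : ContinuousOn (uncurry g) (Ioo a b ×ˢ S)) {θ : EuclideanSpace ℝ ι → ℝ}
    (hθ : Continuous θ) (hθc : HasCompactSupport θ) (hθS : tsupport θ ⊆ S) {s t : ℝ}
    (hs : s ∈ Ioo a b) (ht : t ∈ Ioo a b) :
    ∫ x, θ x • (∫ τ in s..t, g τ x) = ∫ τ in s..t, ∫ x, θ x • g τ x := by
  -- reduce to `s ≤ t`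
  wlog hst : s ≤ t generalizing s t
  · have h := this ht hs (le_of_not_ge hst)
    rw [intervalIntegral.integral_symm, ← h, ← MeasureTheory.integral_neg]
    refine integral_congr_ae (Eventually.of_forall fun x => ?_)
    simp only [intervalIntegral.integral_symm t s, smul_neg]
  -- the integrand `(x, τ) ↦ θ x • g τ x` is integrable on `𝔼 × (s, t]`
  have hIab : Icc s t ⊆ Ioo a b := Icc_subset_Ioo hs.1 ht.2
  set f : EuclideanSpace ℝ ι → ℝ → F := fun x τ => θ x • g τ x with hf
  have hfc : ContinuousOn (uncurry f) (univ ×ˢ Ioo a b) := by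
    rintro ⟨x, τ⟩ ⟨-, hτ⟩
    by_cases hx : x ∈ S
    · have h1 : ContinuousAt (uncurry g) (τ, x) :=
        hg.continuousAt ((isOpen_Ioo.prod hS).mem_nhds ⟨hτ, hx⟩)
      have h2 : ContinuousAt (fun p : EuclideanSpace ℝ ι × ℝ => uncurry g (p.2, p.1)) (x, τ) :=
        ContinuousAt.comp (g := uncurry g) h1 (continuous_snd.prodMk continuous_fst).continuousAt
      exact (((hθ.continuousAt (x := x)).comp continuousAt_fst).smul h2).continuousWithinAt
    · have hx' : x ∉ tsupport θ := fun h => hx (hθS h)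
      have h0 : uncurry f =ᶠ[𝓝 (x, τ)] fun _ => 0 := by
        have h1 : ∀ᶠ p : EuclideanSpace ℝ ι × ℝ in 𝓝 (x, τ), θ p.1 = 0 :=
          (continuous_fst.tendsto (x, τ)).eventually (notMem_tsupport_iff_eventuallyEq.1 hx')
        filter_upwards [h1] with p hp
        simp [hf, uncurry, hp]
      exact ((continuousAt_const (y := (0 : F))).congr h0.symm).continuousWithinAt
  have hK : IsCompact (tsupport θ ×ˢ Icc s t) := hθc.prod isCompact_Icc
  have hfK : IntegrableOn (uncurry f) (tsupport θ ×ˢ Icc s t) (volume.prod volume) :=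
    (hfc.mono (prod_mono (subset_univ _) hIab)).integrableOn_compact hK
  have hfI : IntegrableOn (uncurry f) (univ ×ˢ Ioc s t) (volume.prod volume) := by
    refine (hfK.mono_set (prod_mono Subset.rfl Ioc_subset_Icc_self)).of_forall_sdiff_eq_zero
      (MeasurableSet.univ.prod measurableSet_Ioc) ?_
    rintro ⟨x, τ⟩ ⟨⟨-, hτ⟩, hnot⟩
    have hx : x ∉ tsupport θ := fun hx => hnot ⟨hx, hτ⟩
    simp [hf, uncurry, image_eq_zero_of_notMem_tsupport hx]
  have hfi : Integrable (uncurry f) ((volume : Measure (EuclideanSpace ℝ ι)).prod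
      ((volume : Measure ℝ).restrict (Ioc s t))) := by
    have e : (volume : Measure (EuclideanSpace ℝ ι)).prod ((volume : Measure ℝ).restrict (Ioc s t))
        = ((volume : Measure (EuclideanSpace ℝ ι)).prod (volume : Measure ℝ)).restrict
          (univ ×ˢ Ioc s t) := by
      rw [← Measure.prod_restrict, Measure.restrict_univ]
    rw [e]
    exact hfI
  -- Fubini
  have hswap := MeasureTheory.integral_integral_swap hfi
  simp only [hf] at hswap
  rw [intervalIntegral.integral_of_le hst]
  have e1 : (fun x => θ x • ∫ τ in s..t, g τ x) = fun x => ∫ τ in Ioc s t, θ x • g τ x := by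
    funext x
    rw [intervalIntegral.integral_of_le hst, MeasureTheory.integral_smul]
  rw [e1, hswap]

/-- **A continuous weak solution of `∂ₜ w = g` with continuous right-hand side satisfies
`w(t, x) - w(s, x) = ∫ₛᵗ g(τ, x) dτ` pointwise.** Let `S ⊆ ℝⁿ` be open, `w, g : ℝ → ℝⁿ → F`
jointly continuous on `(a, b) × S`, and suppose that for all smooth `η` compactly supported in
`(a, b)` and all smooth `θ` compactly supported in `S`
`∫∫ ((η'(t) θ(x)) • w(t, x) + (η(t) θ(x)) • g(t, x)) dx dt = 0`
(the identity `∂ₜ w = g` in `𝒟'((a, b) × S)` tested on products). Then for all `x ∈ S` and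
`s, t ∈ (a, b)`, `w(t, x) - w(s, x) = ∫ₛᵗ g(τ, x) dτ`. Proof: for fixed `θ` the pairings
`A(t) = ∫ θ • w(t)`, `B(t) = ∫ θ • g(t)` are continuous and `A' = B` weakly, so
`A(t) - A(s) = ∫ₛᵗ B` (`sub_eq_intervalIntegral_of_forall_test_of_normedSpace`); by Fubini the
continuous field `V = w(t) - w(s) - ∫ₛᵗ g` then satisfies `∫ θ • V = 0` for all `θ`, hence
vanishes on `S` (fundamental lemma of the calculus of variations and continuity).
(Brezis 2011, Thm. 8.2; Serrin 1962, §1.) [cite: Brezis2011, Lemma 8.1] -/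
theorem sub_eq_intervalIntegral_of_forall_product_test [CompleteSpace F] {a b : ℝ}
    {S : Set (EuclideanSpace ℝ ι)} (hS : IsOpen S) {w g : ℝ → EuclideanSpace ℝ ι → F}
    (hw : ContinuousOn (uncurry w) (Ioo a b ×ˢ S)) (hg : ContinuousOn (uncurry g) (Ioo a b ×ˢ S))
    (h : ∀ (η : ℝ → ℝ) (θ : EuclideanSpace ℝ ι → ℝ), ContDiff ℝ ∞ η → HasCompactSupport η →
      tsupport η ⊆ Ioo a b → ContDiff ℝ ∞ θ → HasCompactSupport θ → tsupport θ ⊆ S →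
      ∫ t, ∫ x, ((deriv η t * θ x) • w t x + (η t * θ x) • g t x) = 0)
    {x : EuclideanSpace ℝ ι} (hx : x ∈ S) {s t : ℝ} (hs : s ∈ Ioo a b) (ht : t ∈ Ioo a b) :
    w t x - w s x = ∫ τ in s..t, g τ x := by
  -- the continuous field `V = w t - w s - ∫ₛᵗ g`
  set V : EuclideanSpace ℝ ι → F := fun y => w t y - w s y - ∫ τ in s..t, g τ y with hV
  have hVc : ContinuousOn V S :=
    ((hw.uncurry_left t ht).sub (hw.uncurry_left s hs)).sub
      (continuousOn_intervalIntegral_of_continuousOn_prod hS hg hs ht)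
  -- `∫ θ • V = 0` for every test function `θ` supported in `S`
  have hV0 : ∀ θ : EuclideanSpace ℝ ι → ℝ, ContDiff ℝ ∞ θ → HasCompactSupport θ →
      tsupport θ ⊆ S → ∫ y, θ y • V y = 0 := by
    intro θ hθ hθc hθS
    -- the pairings `A`, `B` and the weak identity `A' = B`
    set A : ℝ → F := fun τ => ∫ y, θ y • w τ y with hA
    set B : ℝ → F := fun τ => ∫ y, θ y • g τ y with hB
    have hAc : ContinuousOn A (Ioo a b) :=
      continuousOn_integral_smul_of_continuousOn_prod hS hw hθ.continuous hθc hθS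
    have hBc : ContinuousOn B (Ioo a b) :=
      continuousOn_integral_smul_of_continuousOn_prod hS hg hθ.continuous hθc hθS
    have hint : ∀ {u : ℝ → EuclideanSpace ℝ ι → F}, ContinuousOn (uncurry u) (Ioo a b ×ˢ S) →
        ∀ τ ∈ Ioo a b, Integrable (fun y => θ y • u τ y) volume := fun {u} hu τ hτ =>
      (continuous_smul_of_continuousOn_of_tsupport_subset hS
        (hu.uncurry_left τ hτ) hθ.continuous hθS).integrable_of_hasCompactSupport
        (hθc.mono' support_smul_subset_tsupport)
    have hAB : ∀ η : ℝ → ℝ, ContDiff ℝ ∞ η → HasCompactSupport η → tsupport η ⊆ Ioo a b →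
        ∫ τ in Ioo a b, (deriv η τ • A τ + η τ • B τ) = 0 := by
      intro η hη hηc hηs
      have hη0 : ∀ τ, τ ∉ Ioo a b → η τ = 0 := fun τ hτ =>
        image_eq_zero_of_notMem_tsupport fun h' => hτ (hηs h')
      have hdη0 : ∀ τ, τ ∉ Ioo a b → deriv η τ = 0 := fun τ hτ => by
        by_contra h'
        exact hτ (hηs (support_deriv_subset (mem_support.2 h')))
      have hinner : ∀ τ, ∫ y, ((deriv η τ * θ y) • w τ y + (η τ * θ y) • g τ y) =
          deriv η τ • A τ + η τ • B τ := by
        intro τ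
        by_cases hτ : τ ∈ Ioo a b
        · simp only [hA, hB, mul_smul]
          have h1' : Integrable (fun y => deriv η τ • θ y • w τ y) volume :=
            (hint hw τ hτ).smul (deriv η τ)
          have h2' : Integrable (fun y => η τ • θ y • g τ y) volume := (hint hg τ hτ).smul (η τ)
          rw [integral_add h1' h2', MeasureTheory.integral_smul, MeasureTheory.integral_smul]
        · simp [hη0 τ hτ, hdη0 τ hτ]
      have h1 := h η θ hη hηc hηs hθ hθc hθS
      simp_rw [hinner] at h1
      rw [← h1]
      refine setIntegral_Ioo_eq_integral_of_support_subset fun τ hτ => ?_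
      by_contra hτ'
      simp [hη0 τ hτ', hdη0 τ hτ'] at hτ
    have hAt := sub_eq_intervalIntegral_of_forall_test_of_normedSpace hAc hBc hAB hs ht
    -- assemble with Fubini
    have hi1 : Integrable (fun y => θ y • w t y) volume := hint hw t ht
    have hi2 : Integrable (fun y => θ y • w s y) volume := hint hw s hs
    have hi3 : Integrable (fun y => θ y • ∫ τ in s..t, g τ y) volume :=
      (continuous_smul_of_continuousOn_of_tsupport_subset hS
        (continuousOn_intervalIntegral_of_continuousOn_prod hS hg hs ht) hθ.continuous hθS)
        |>.integrable_of_hasCompactSupport (hθc.mono' support_smul_subset_tsupport)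
    have e : (fun y => θ y • V y) = fun y =>
        (θ y • w t y - θ y • w s y) - θ y • ∫ τ in s..t, g τ y := by
      funext y; simp only [hV, smul_sub]
    have hi12 : Integrable (fun y => θ y • w t y - θ y • w s y) volume := hi1.sub hi2
    rw [e, integral_sub hi12 hi3, integral_sub hi1 hi2,
      integral_smul_intervalIntegral_comm hS hg hθ.continuous hθc hθS hs ht]
    change A t - A s - ∫ τ in s..t, B τ = 0
    rw [hAt, sub_self]
  -- the fundamental lemma of the calculus of variations, and continuity
  have hae : ∀ᵐ y ∂volume, y ∈ S → V y = 0 :=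
    hS.ae_eq_zero_of_integral_contDiff_smul_eq_zero (hVc.locallyIntegrableOn hS.measurableSet) hV0
  have hV00 : EqOn V 0 S :=
    Measure.eqOn_open_of_ae_eq ((ae_restrict_iff' hS.measurableSet).2 hae) hS hVc
      continuousOn_const
  have := hV00 hx
  simp only [hV, Pi.zero_apply] at this
  exact sub_eq_zero.1 this

/-- **The classical time derivative of a continuous weak solution of `∂ₜ w = g`.** Under the
hypotheses of `sub_eq_intervalIntegral_of_forall_product_test`, for every `x ∈ S` the time
line `t ↦ w(t, x)` is differentiable at every `t ∈ (a, b)` with derivative `g(t, x)` (the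
fundamental theorem of calculus for the continuous integrand `τ ↦ g(τ, x)`). [cite: Brezis2011, Thm. 8.2] -/
theorem hasDerivAt_of_forall_product_test [CompleteSpace F] {a b : ℝ}
    {S : Set (EuclideanSpace ℝ ι)} (hS : IsOpen S) {w g : ℝ → EuclideanSpace ℝ ι → F}
    (hw : ContinuousOn (uncurry w) (Ioo a b ×ˢ S)) (hg : ContinuousOn (uncurry g) (Ioo a b ×ˢ S))
    (h : ∀ (η : ℝ → ℝ) (θ : EuclideanSpace ℝ ι → ℝ), ContDiff ℝ ∞ η → HasCompactSupport η →
      tsupport η ⊆ Ioo a b → ContDiff ℝ ∞ θ → HasCompactSupport θ → tsupport θ ⊆ S →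
      ∫ t, ∫ x, ((deriv η t * θ x) • w t x + (η t * θ x) • g t x) = 0)
    {x : EuclideanSpace ℝ ι} (hx : x ∈ S) {t : ℝ} (ht : t ∈ Ioo a b) :
    HasDerivAt (fun τ => w τ x) (g t x) t := by
  -- `w τ x = w t x + ∫ₜ^τ g(r, x) dr` for `τ ∈ (a, b)`
  have heq : (fun τ => w t x + ∫ r in t..τ, g r x) =ᶠ[𝓝 t] fun τ => w τ x := by
    filter_upwards [Ioo_mem_nhds ht.1 ht.2] with τ hτ
    rw [← sub_eq_intervalIntegral_of_forall_product_test hS hw hg h hx ht hτ]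
    abel
  have hgx : ContinuousOn (fun r => g r x) (Ioo a b) := hg.uncurry_right x hx
  have hprim : HasDerivAt (fun τ => ∫ r in t..τ, g r x) (g t x) t :=
    intervalIntegral.integral_hasDerivAt_right IntervalIntegrable.refl
      (hgx.stronglyMeasurableAtFilter isOpen_Ioo t ht) (hgx.continuousAt (Ioo_mem_nhds ht.1 ht.2))
  have h2 : HasDerivAt (fun τ => w t x + ∫ r in t..τ, g r x) (g t x) t := by
    simpa using hprim.const_add (w t x)
  exact h2.congr_of_eventuallyEq heq.symm

end Fields

section ScalarDerivative

/-- **du Bois-Reymond with a right-hand side — classical derivative (scalar form)**: if `A, B` are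
continuous on `(a, b)` and `∫ (η' A + η B) = 0` for every smooth `η` compactly supported in `(a, b)`,
then `A` has derivative `B t` at every `t ∈ (a, b)` (from `sub_eq_intervalIntegral_of_forall_test`,
`A u = A t + ∫ₜᵘ B` near `t`, and the fundamental theorem of calculus for the continuous integrand
`B`).  The scalar companion of `hasDerivAt_of_forall_product_test`. [cite: Brezis2011, Lemma 8.1] -/
theorem hasDerivAt_of_forall_test {a b : ℝ} {A B : ℝ → ℝ}
    (hA : ContinuousOn A (Ioo a b)) (hB : ContinuousOn B (Ioo a b))
    (h : ∀ η : ℝ → ℝ, ContDiff ℝ ∞ η → HasCompactSupport η → tsupport η ⊆ Ioo a b →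
      ∫ t in Ioo a b, (deriv η t * A t + η t * B t) = 0)
    {t : ℝ} (ht : t ∈ Ioo a b) : HasDerivAt A (B t) t := by
  have hF : HasDerivAt (fun u => A t + ∫ τ in t..u, B τ) (B t) t := by
    have h1 : HasDerivAt (fun u => ∫ τ in t..u, B τ) (B t) t :=
      intervalIntegral.integral_hasDerivAt_right IntervalIntegrable.refl
        (hB.stronglyMeasurableAtFilter isOpen_Ioo t ht) (hB.continuousAt (isOpen_Ioo.mem_nhds ht))
    simpa using h1.const_add (A t)
  refine hF.congr_of_eventuallyEq ?_
  filter_upwards [isOpen_Ioo.mem_nhds ht] with u hu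
  rw [← sub_eq_intervalIntegral_of_forall_test hA hB h ht hu]
  ring

end ScalarDerivative

end Literature.Analysis.FunctionSpaces
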